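import Summits.CriticalPhenomena.Ising3D.Control2DOpeEpsCells
import Summits.CriticalPhenomena.Ising3D.Control2DL11OpeEUAData10
import Summits.CriticalPhenomena.Ising3D.Control2DL11OpeEUAData7
import Summits.CriticalPhenomena.Ising3D.Control2DL11OpeEUAData8
import Summits.CriticalPhenomena.Ising3D.Control2DL11OpeEUAData9
import Summits.CriticalPhenomena.Ising3D.Control2DL11OpeEUARegion
import Summits.CriticalPhenomena.Ising3D.Control2DOpeEpsKernel
import Mathlib.Tactic.IntervalCases
import Mathlib.Tactic.Linarith
import Mathlib.Tactic.NormNum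
import HarnessLib

/-!
# A kind-`ope2eps` (sense UPPER) 2D γ-certificate in the kernel: `W(box) < 127743/2000000` at `Δ_σ = 1/8` under `A2D′` (Λ = 11)
(cell `pub-ising3x`, seat controls-1 gen 21; KERNEL PATH for the 2D γ-certificates, kind `ope2eps` (the λ²_σσε datum) — CONTROL-ONLY)

HONEST FRAMING: lottery ticket; floor = tightest certified 3D Ising CFT bounds; no exact-solution
claim without a proof. CONTROL-ONLY: `d = 2`, global blocks, `Δ_σ = 1/8` exact, the 2D axiom set `A2D′` with the
CERTIFIED `ε` box `[197/200, 20001/20000]` as scalar input; `W = Σ_(ℓ=0, Δ_i in the box) p_i 2^(-Δ_i)` is the weighted in-box scalar content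
(`Control2DOpeEpsTwoSided`; `pBoxTwoSided_rb6_L11` turns the (lower, upper) pair into two-sided bounds on `p_box` and `λ²_σσ[box] = 2 p_box`).

**`opeEpsUpper_2d_L11_opeEUA : OpeEpsUpperA2D (1/8) 2 1 (197 / 200) (20001 / 20000) (127743/2000000)`** — from the RB-6 ope2eps (sense upper) certificate `j139947_functional_deriv2d_L11_E032_sig1o8_ope2epsupper_P127743o2000000.json` (Λ = 11, E₀ = 32): W(box) < 127743/2000000 at Δ_σ = 1/8 under A2D′, W = Σ_(ℓ=0, Δ ∈ [197/200, 20001/20000]) p_i 2^(-Δ_i) (⇒ λ²_σσ[box] < 2·2^(20001/20000)·127743/2000000), with EVERY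
obligation re-decided in the Lean kernel: per box cell (I″) and the SIGN of the truncated scalar block
as Bernstein decisions on the spin-0 literal (`epsChk*_opeEUA_l*`, `Control2DOpeEpsKernel`), (R) by `region_of_kernelCertAuto`, cells `cells_opeEUA`
(`OpeEpsCellsN`: (C′), the stress-tensor point, spin 2 on [3, E₀), even spins ≥ 4). Zero grant compute. No facts, standard axioms only.

`cells_opeEUA`: every cell obligation of the certificate ((E) on the ε box, (C′) scalars on [2, E₀), the stress-tensor point (T), spin 2 on [3, E₀), even spins ≥ 4 on [ℓ, E₀); E₀ = 32), in the witness form `∃ N ≥ E₀` with the spin's own truncation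
order, from the kernel-decided Bernstein leaves of `Control2DL11OpeEUAData*` via `cell_nonneg_of_bernCheck`. No facts, standard axioms only.

ONE MODULE for the cells theorem and the assembly (controls-1 g20): every gate dependency level waits for the farm's tree build to catch
up with the freshly landed imports (measured 1–2 h per level under load, `remote:stale:…:unbuilt`), so the cells theorem below is not a
separate `…Cells` module as in the earlier replays; statements and proofs are unchanged.
-/

namespace Summit.CriticalPhenomena.Ising3D.Control2D

open Finset Set
open Literature.MathematicalPhysics.QuantumFieldTheory.ConformalBootstrap3D

set_option maxHeartbeats 0 in
set_option maxRecDepth 200000 in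
/-- **The cells of the certificate** (W(box) < 127743/2000000 at Δ_σ = 1/8 under A2D′, W = Σ_(ℓ=0, Δ ∈ [197/200, 20001/20000]) p_i 2^(-Δ_i) (⇒ λ²_σσ[box] < 2·2^(20001/20000)·127743/2000000); `E₀ = 32`; truncation `N = Nd + 1` per spin:
ℓ=0: 48, ℓ=2: 40, ℓ=4: 40, ℓ=6: 40, ℓ=8: 40 ; others `N = 32`). [folklore] -/
theorem cells_opeEUA :
    OpeEpsCellsN slL11.toFinset (fun p => (wtopeEUA p : ℝ)) (1 / 8) 2 1 32 := by
  refine ⟨?_, ?_, ?_, ?_⟩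
  · intro Δ h1 h2
    replace h2 := h2.le
    refine ⟨47 + 1, by norm_num, ?_⟩
    rcases le_or_gt Δ ((47 : ℝ) / 16) with hd0 | hd0
    · exact cell_nonneg_of_bernAuto_trunc wtopeEUA slL11_nodup slL11_deg 0 47 284 (q := 32) (a := 32) (L := 15) (by norm_num) (by norm_num) (by norm_num) (by rw [phatopeEUAs0_eq]; exact cellChk_opeEUA_s0l0) (by norm_num; linarith) (by norm_num; linarith)
    rcases le_or_gt Δ ((31 : ℝ) / 8) with hd1 | hd1
    · exact cell_nonneg_of_bernAuto_trunc wtopeEUA slL11_nodup slL11_deg 0 47 284 (q := 32) (a := 47) (L := 15) (by norm_num) (by norm_num) (by norm_num) (by rw [phatopeEUAs0_eq]; exact cellChk_opeEUA_s0l1) (by norm_num; linarith) (by norm_num; linarith)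
    rcases le_or_gt Δ ((77 : ℝ) / 16) with hd2 | hd2
    · exact cell_nonneg_of_bernAuto_trunc wtopeEUA slL11_nodup slL11_deg 0 47 284 (q := 32) (a := 62) (L := 15) (by norm_num) (by norm_num) (by norm_num) (by rw [phatopeEUAs0_eq]; exact cellChk_opeEUA_s0l2) (by norm_num; linarith) (by norm_num; linarith)
    rcases le_or_gt Δ ((169 : ℝ) / 32) with hd3 | hd3
    · exact cell_nonneg_of_bernAuto_trunc wtopeEUA slL11_nodup slL11_deg 0 47 284 (q := 64) (a := 154) (L := 15) (by norm_num) (by norm_num) (by norm_num) (by rw [phatopeEUAs0_eq]; exact cellChk_opeEUA_s0l3) (by norm_num; linarith) (by norm_num; linarith)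
    rcases le_or_gt Δ ((23 : ℝ) / 4) with hd4 | hd4
    · exact cell_nonneg_of_bernAuto_trunc wtopeEUA slL11_nodup slL11_deg 0 47 284 (q := 64) (a := 169) (L := 15) (by norm_num) (by norm_num) (by norm_num) (by rw [phatopeEUAs0_eq]; exact cellChk_opeEUA_s0l4) (by norm_num; linarith) (by norm_num; linarith)
    rcases le_or_gt Δ ((19 : ℝ) / 2) with hd5 | hd5
    · exact cell_nonneg_of_bernAuto_trunc wtopeEUA slL11_nodup slL11_deg 0 47 284 (q := 8) (a := 23) (L := 15) (by norm_num) (by norm_num) (by norm_num) (by rw [phatopeEUAs0_eq]; exact cellChk_opeEUA_s0l5) (by norm_num; linarith) (by norm_num; linarith)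
    rcases le_or_gt Δ (17 : ℝ) with hd6 | hd6
    · exact cell_nonneg_of_bernAuto_trunc wtopeEUA slL11_nodup slL11_deg 0 47 284 (q := 4) (a := 19) (L := 15) (by norm_num) (by norm_num) (by norm_num) (by rw [phatopeEUAs0_eq]; exact cellChk_opeEUA_s0l6) (by norm_num; linarith) (by norm_num; linarith)
    exact cell_nonneg_of_bernAuto_trunc wtopeEUA slL11_nodup slL11_deg 0 47 284 (q := 2) (a := 17) (L := 15) (by norm_num) (by norm_num) (by norm_num) (by rw [phatopeEUAs0_eq]; exact cellChk_opeEUA_s0l7) (by norm_num; linarith) (by norm_num; linarith)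
  · refine ⟨39 + 1, by norm_num, ?_⟩
    exact cell_nonneg_of_bernAuto_trunc wtopeEUA slL11_nodup slL11_deg 2 39 232 (q := 1) (a := 0) (L := 0) (by norm_num) (by norm_num) (by norm_num) (by rw [phatopeEUAs2_eq]; exact cellChk_opeEUA_s2l0) (by norm_num) (by norm_num)
  · intro Δ h1 h2
    replace h1 : (3 : ℝ) ≤ Δ := by linarith
    replace h2 := h2.le
    refine ⟨39 + 1, by norm_num, ?_⟩
    rcases le_or_gt Δ ((77 : ℝ) / 16) with hd0 | hd0
    · exact cell_nonneg_of_bernAuto_trunc wtopeEUA slL11_nodup slL11_deg 2 39 232 (q := 32) (a := 16) (L := 29) (by norm_num) (by norm_num) (by norm_num) (by rw [phatopeEUAs2_eq]; exact cellChk_opeEUA_s2l1) (by norm_num; linarith) (by norm_num; linarith)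
    rcases le_or_gt Δ ((183 : ℝ) / 32) with hd1 | hd1
    · exact cell_nonneg_of_bernAuto_trunc wtopeEUA slL11_nodup slL11_deg 2 39 232 (q := 64) (a := 90) (L := 29) (by norm_num) (by norm_num) (by norm_num) (by rw [phatopeEUAs2_eq]; exact cellChk_opeEUA_s2l2) (by norm_num; linarith) (by norm_num; linarith)
    rcases le_or_gt Δ ((761 : ℝ) / 128) with hd2 | hd2
    · exact cell_nonneg_of_bernAuto_trunc wtopeEUA slL11_nodup slL11_deg 2 39 232 (q := 256) (a := 476) (L := 29) (by norm_num) (by norm_num) (by norm_num) (by rw [phatopeEUAs2_eq]; exact cellChk_opeEUA_s2l3) (by norm_num; linarith) (by norm_num; linarith)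
    rcases le_or_gt Δ ((395 : ℝ) / 64) with hd3 | hd3
    · exact cell_nonneg_of_bernAuto_trunc wtopeEUA slL11_nodup slL11_deg 2 39 232 (q := 256) (a := 505) (L := 29) (by norm_num) (by norm_num) (by norm_num) (by rw [phatopeEUAs2_eq]; exact cellChk_opeEUA_s2l4) (by norm_num; linarith) (by norm_num; linarith)
    rcases le_or_gt Δ ((53 : ℝ) / 8) with hd4 | hd4
    · exact cell_nonneg_of_bernAuto_trunc wtopeEUA slL11_nodup slL11_deg 2 39 232 (q := 128) (a := 267) (L := 29) (by norm_num) (by norm_num) (by norm_num) (by rw [phatopeEUAs2_eq]; exact cellChk_opeEUA_s2l5) (by norm_num; linarith) (by norm_num; linarith)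
    rcases le_or_gt Δ ((41 : ℝ) / 4) with hd5 | hd5
    · exact cell_nonneg_of_bernAuto_trunc wtopeEUA slL11_nodup slL11_deg 2 39 232 (q := 16) (a := 37) (L := 29) (by norm_num) (by norm_num) (by norm_num) (by rw [phatopeEUAs2_eq]; exact cellChk_opeEUA_s2l6) (by norm_num; linarith) (by norm_num; linarith)
    rcases le_or_gt Δ ((35 : ℝ) / 2) with hd6 | hd6
    · exact cell_nonneg_of_bernAuto_trunc wtopeEUA slL11_nodup slL11_deg 2 39 232 (q := 8) (a := 33) (L := 29) (by norm_num) (by norm_num) (by norm_num) (by rw [phatopeEUAs2_eq]; exact cellChk_opeEUA_s2l7) (by norm_num; linarith) (by norm_num; linarith)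
    exact cell_nonneg_of_bernAuto_trunc wtopeEUA slL11_nodup slL11_deg 2 39 232 (q := 4) (a := 31) (L := 29) (by norm_num) (by norm_num) (by norm_num) (by rw [phatopeEUAs2_eq]; exact cellChk_opeEUA_s2l8) (by norm_num; linarith) (by norm_num; linarith)
  · intro ℓ hℓ hℓ0 hℓ2 Δ hℓΔ hΔ
    have hℓR : (ℓ : ℝ) < 32 := lt_of_le_of_lt hℓΔ hΔ
    have hℓE : ℓ < 32 := by exact_mod_cast hℓR
    replace h2 := hΔ.le
    interval_cases ℓ
    · exact absurd rfl hℓ0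
    · exact absurd hℓ (by decide)
    · exact absurd rfl hℓ2
    · exact absurd hℓ (by decide)
    · have h1 : (4 : ℝ) ≤ Δ := by exact_mod_cast hℓΔ
      refine ⟨39 + 1, by norm_num, ?_⟩
      rcases le_or_gt Δ ((23 : ℝ) / 4) with hd0 | hd0
      · exact cell_nonneg_of_bernAuto_trunc wtopeEUA slL11_nodup slL11_deg 4 39 235 (q := 8) (a := 0) (L := 7) (by norm_num) (by norm_num) (by norm_num) (by rw [phatopeEUAs4_eq]; exact cellChk_opeEUA_s4l0) (by norm_num; linarith) (by norm_num; linarith)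
      rcases le_or_gt Δ ((53 : ℝ) / 8) with hd1 | hd1
      · exact cell_nonneg_of_bernAuto_trunc wtopeEUA slL11_nodup slL11_deg 4 39 235 (q := 16) (a := 14) (L := 7) (by norm_num) (by norm_num) (by norm_num) (by rw [phatopeEUAs4_eq]; exact cellChk_opeEUA_s4l1) (by norm_num; linarith) (by norm_num; linarith)
      rcases le_or_gt Δ ((15 : ℝ) / 2) with hd2 | hd2
      · exact cell_nonneg_of_bernAuto_trunc wtopeEUA slL11_nodup slL11_deg 4 39 235 (q := 16) (a := 21) (L := 7) (by norm_num) (by norm_num) (by norm_num) (by rw [phatopeEUAs4_eq]; exact cellChk_opeEUA_s4l2) (by norm_num; linarith) (by norm_num; linarith)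
      rcases le_or_gt Δ (11 : ℝ) with hd3 | hd3
      · exact cell_nonneg_of_bernAuto_trunc wtopeEUA slL11_nodup slL11_deg 4 39 235 (q := 4) (a := 7) (L := 7) (by norm_num) (by norm_num) (by norm_num) (by rw [phatopeEUAs4_eq]; exact cellChk_opeEUA_s4l3) (by norm_num; linarith) (by norm_num; linarith)
      rcases le_or_gt Δ (18 : ℝ) with hd4 | hd4
      · exact cell_nonneg_of_bernAuto_trunc wtopeEUA slL11_nodup slL11_deg 4 39 235 (q := 2) (a := 7) (L := 7) (by norm_num) (by norm_num) (by norm_num) (by rw [phatopeEUAs4_eq]; exact cellChk_opeEUA_s4l4) (by norm_num; linarith) (by norm_num; linarith)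
      exact cell_nonneg_of_bernAuto_trunc wtopeEUA slL11_nodup slL11_deg 4 39 235 (q := 1) (a := 7) (L := 7) (by norm_num) (by norm_num) (by norm_num) (by rw [phatopeEUAs4_eq]; exact cellChk_opeEUA_s4l5) (by norm_num; linarith) (by norm_num; linarith)
    · exact absurd hℓ (by decide)
    · have h1 : (6 : ℝ) ≤ Δ := by exact_mod_cast hℓΔ
      refine ⟨39 + 1, by norm_num, ?_⟩
      rcases le_or_gt Δ ((61 : ℝ) / 8) with hd0 | hd0
      · exact cell_nonneg_of_bernAuto_trunc wtopeEUA slL11_nodup slL11_deg 6 39 240 (q := 16) (a := 0) (L := 13) (by norm_num) (by norm_num) (by norm_num) (by rw [phatopeEUAs6_eq]; exact cellChk_opeEUA_s6l0) (by norm_num; linarith) (by norm_num; linarith)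
      rcases le_or_gt Δ ((37 : ℝ) / 4) with hd1 | hd1
      · exact cell_nonneg_of_bernAuto_trunc wtopeEUA slL11_nodup slL11_deg 6 39 240 (q := 16) (a := 13) (L := 13) (by norm_num) (by norm_num) (by norm_num) (by rw [phatopeEUAs6_eq]; exact cellChk_opeEUA_s6l1) (by norm_num; linarith) (by norm_num; linarith)
      rcases le_or_gt Δ ((25 : ℝ) / 2) with hd2 | hd2
      · exact cell_nonneg_of_bernAuto_trunc wtopeEUA slL11_nodup slL11_deg 6 39 240 (q := 8) (a := 13) (L := 13) (by norm_num) (by norm_num) (by norm_num) (by rw [phatopeEUAs6_eq]; exact cellChk_opeEUA_s6l2) (by norm_num; linarith) (by norm_num; linarith)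
      rcases le_or_gt Δ (19 : ℝ) with hd3 | hd3
      · exact cell_nonneg_of_bernAuto_trunc wtopeEUA slL11_nodup slL11_deg 6 39 240 (q := 4) (a := 13) (L := 13) (by norm_num) (by norm_num) (by norm_num) (by rw [phatopeEUAs6_eq]; exact cellChk_opeEUA_s6l3) (by norm_num; linarith) (by norm_num; linarith)
      exact cell_nonneg_of_bernAuto_trunc wtopeEUA slL11_nodup slL11_deg 6 39 240 (q := 2) (a := 13) (L := 13) (by norm_num) (by norm_num) (by norm_num) (by rw [phatopeEUAs6_eq]; exact cellChk_opeEUA_s6l4) (by norm_num; linarith) (by norm_num; linarith)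
    · exact absurd hℓ (by decide)
    · have h1 : (8 : ℝ) ≤ Δ := by exact_mod_cast hℓΔ
      refine ⟨39 + 1, by norm_num, ?_⟩
      exact cell_nonneg_of_bernAuto_trunc wtopeEUA slL11_nodup slL11_deg 8 39 244 (q := 1) (a := 0) (L := 12) (by norm_num) (by norm_num) (by norm_num) (by rw [phatopeEUAs8_eq]; exact cellChk_opeEUA_s8l0) (by norm_num; linarith) (by norm_num; linarith)
    · exact absurd hℓ (by decide)
    · have h1 : (10 : ℝ) ≤ Δ := by exact_mod_cast hℓΔ
      refine ⟨31 + 1, by norm_num, ?_⟩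
      exact cell_nonneg_of_bernAuto_trunc wtopeEUA slL11_nodup slL11_deg 10 31 191 (q := 1) (a := 0) (L := 11) (by norm_num) (by norm_num) (by norm_num) (by rw [phatopeEUAs10_eq]; exact cellChk_opeEUA_s10l0) (by norm_num; linarith) (by norm_num; linarith)
    · exact absurd hℓ (by decide)
    · have h1 : (12 : ℝ) ≤ Δ := by exact_mod_cast hℓΔ
      refine ⟨31 + 1, by norm_num, ?_⟩
      exact cell_nonneg_of_bernAuto_trunc wtopeEUA slL11_nodup slL11_deg 12 31 193 (q := 1) (a := 0) (L := 10) (by norm_num) (by norm_num) (by norm_num) (by rw [phatopeEUAs12_eq]; exact cellChk_opeEUA_s12l0) (by norm_num; linarith) (by norm_num; linarith)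
    · exact absurd hℓ (by decide)
    · have h1 : (14 : ℝ) ≤ Δ := by exact_mod_cast hℓΔ
      refine ⟨31 + 1, by norm_num, ?_⟩
      exact cell_nonneg_of_bernAuto_trunc wtopeEUA slL11_nodup slL11_deg 14 31 195 (q := 1) (a := 0) (L := 9) (by norm_num) (by norm_num) (by norm_num) (by rw [phatopeEUAs14_eq]; exact cellChk_opeEUA_s14l0) (by norm_num; linarith) (by norm_num; linarith)
    · exact absurd hℓ (by decide)
    · have h1 : (16 : ℝ) ≤ Δ := by exact_mod_cast hℓΔ
      refine ⟨31 + 1, by norm_num, ?_⟩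
      exact cell_nonneg_of_bernAuto_trunc wtopeEUA slL11_nodup slL11_deg 16 31 197 (q := 1) (a := 0) (L := 8) (by norm_num) (by norm_num) (by norm_num) (by rw [phatopeEUAs16_eq]; exact cellChk_opeEUA_s16l0) (by norm_num; linarith) (by norm_num; linarith)
    · exact absurd hℓ (by decide)
    · have h1 : (18 : ℝ) ≤ Δ := by exact_mod_cast hℓΔ
      refine ⟨31 + 1, by norm_num, ?_⟩
      exact cell_nonneg_of_bernAuto_trunc wtopeEUA slL11_nodup slL11_deg 18 31 199 (q := 1) (a := 0) (L := 7) (by norm_num) (by norm_num) (by norm_num) (by rw [phatopeEUAs18_eq]; exact cellChk_opeEUA_s18l0) (by norm_num; linarith) (by norm_num; linarith)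
    · exact absurd hℓ (by decide)
    · have h1 : (20 : ℝ) ≤ Δ := by exact_mod_cast hℓΔ
      refine ⟨31 + 1, by norm_num, ?_⟩
      exact cell_nonneg_of_bernAuto_trunc wtopeEUA slL11_nodup slL11_deg 20 31 201 (q := 1) (a := 0) (L := 6) (by norm_num) (by norm_num) (by norm_num) (by rw [phatopeEUAs20_eq]; exact cellChk_opeEUA_s20l0) (by norm_num; linarith) (by norm_num; linarith)
    · exact absurd hℓ (by decide)
    · have h1 : (22 : ℝ) ≤ Δ := by exact_mod_cast hℓΔ
      refine ⟨31 + 1, by norm_num, ?_⟩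
      exact cell_nonneg_of_bernAuto_trunc wtopeEUA slL11_nodup slL11_deg 22 31 202 (q := 1) (a := 0) (L := 5) (by norm_num) (by norm_num) (by norm_num) (by rw [phatopeEUAs22_eq]; exact cellChk_opeEUA_s22l0) (by norm_num; linarith) (by norm_num; linarith)
    · exact absurd hℓ (by decide)
    · have h1 : (24 : ℝ) ≤ Δ := by exact_mod_cast hℓΔ
      refine ⟨31 + 1, by norm_num, ?_⟩
      exact cell_nonneg_of_bernAuto_trunc wtopeEUA slL11_nodup slL11_deg 24 31 204 (q := 1) (a := 0) (L := 4) (by norm_num) (by norm_num) (by norm_num) (by rw [phatopeEUAs24_eq]; exact cellChk_opeEUA_s24l0) (by norm_num; linarith) (by norm_num; linarith)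
    · exact absurd hℓ (by decide)
    · have h1 : (26 : ℝ) ≤ Δ := by exact_mod_cast hℓΔ
      refine ⟨31 + 1, by norm_num, ?_⟩
      exact cell_nonneg_of_bernAuto_trunc wtopeEUA slL11_nodup slL11_deg 26 31 205 (q := 1) (a := 0) (L := 3) (by norm_num) (by norm_num) (by norm_num) (by rw [phatopeEUAs26_eq]; exact cellChk_opeEUA_s26l0) (by norm_num; linarith) (by norm_num; linarith)
    · exact absurd hℓ (by decide)
    · have h1 : (28 : ℝ) ≤ Δ := by exact_mod_cast hℓΔ
      refine ⟨31 + 1, by norm_num, ?_⟩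
      exact cell_nonneg_of_bernAuto_trunc wtopeEUA slL11_nodup slL11_deg 28 31 206 (q := 1) (a := 0) (L := 2) (by norm_num) (by norm_num) (by norm_num) (by rw [phatopeEUAs28_eq]; exact cellChk_opeEUA_s28l0) (by norm_num; linarith) (by norm_num; linarith)
    · exact absurd hℓ (by decide)
    · have h1 : (30 : ℝ) ≤ Δ := by exact_mod_cast hℓΔ
      refine ⟨31 + 1, by norm_num, ?_⟩
      exact cell_nonneg_of_bernAuto_trunc wtopeEUA slL11_nodup slL11_deg 30 31 208 (q := 1) (a := 0) (L := 1) (by norm_num) (by norm_num) (by norm_num) (by rw [phatopeEUAs30_eq]; exact cellChk_opeEUA_s30l0) (by norm_num; linarith) (by norm_num; linarith)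
    · exact absurd hℓ (by decide)

/-- **2D control, γ-architecture, kind `ope2eps` (UPPER sense), kernel-complete: under `A2D′` at `Δ_σ = 1/8` with the `ε` box
`[197/200, 20001/20000]`, `W(box) < 127743/2000000`**, every obligation of the Λ = 11 functional checked in the Lean kernel. CONTROL-ONLY (d = 2).
[cite: RattazziEtAl2008, §5.5] -/
theorem opeEpsUpper_2d_L11_opeEUA : OpeEpsUpperA2D (1 / 8 : ℝ) 2 1 (197 / 200) (20001 / 20000) (127743 / 2000000) := by
  have hbox : ∀ Δ : ℝ, (197 / 200 : ℝ) ≤ Δ → Δ ≤ 20001 / 20000 → ∃ N : ℕ, (32 : ℝ) ≤ Δ + N ∧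
      0 < taylorFunctional2D (1 / 2) slL11.toFinset (fun p => (wtopeEUA p : ℝ)) (crossF (1 / 8) (-1) (QN N 0 Δ)) ∧
      0 < taylorFunctional2D (1 / 2) slL11.toFinset (fun p => (wtopeEUA p : ℝ)) (crossF (1 / 8) (-1) (fun _ _ => (1 : ℝ))) +
        (((127743 : ℕ) : ℝ) / ((2000000 : ℕ) : ℝ)) * ((2 : ℝ) ^ Δ * taylorFunctional2D (1 / 2) slL11.toFinset (fun p => (wtopeEUA p : ℝ)) (crossF (1 / 8) (-1) (QN N 0 Δ))) := by
    intro Δ h1 h2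
    refine ⟨47 + 1, by norm_num at h1 ⊢; linarith, ?_, ?_⟩
    · exact epsSignUpper_of_bernAuto_trunc wtopeEUA slL11_nodup slL11_deg 47 284 (q := 40000) (a := 19700) (L := 301) (by norm_num) (by norm_num) (by norm_num) (by rw [phatopeEUAs0_eq]; exact epsChkU_opeEUA_l0) (by norm_num; linarith) (by norm_num; linarith)
    · exact epsIdent_of_bernAuto_trunc wtopeEUA slL11_nodup slL11_deg 47 289 (Pn := 127743) (Pd := 2000000) (by norm_num) (q := 40000) (a := 19700) (L := 301) (by norm_num) (by norm_num) (by norm_num) (by unfold epsIdentPolyZ; rw [phatopeEUAs0_eq]; exact epsChkI_opeEUA_l0) (by norm_num; linarith) (by norm_num; linarith)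
  have h := opeEpsUpper_half_of_cellsN slL11.toFinset (fun p => (wtopeEUA p : ℝ)) (s := 1 / 8) (G := 2) (δ := 1) (E₀ := 32)
    (by norm_num) (by norm_num) (by norm_num) (by norm_num) (by norm_num) (by norm_num) hbox
    (region_of_kernelCertAuto wtopeEUA slL11_nodup slL11_deg 11 12 (by norm_num) (by norm_num) PregopeEUA_eq
      (by decide +kernel) QhatopeEUA_eq _ cregopeEUA_n0 cregJopeEUA (by decide) cregJopeEUA_ok) cells_opeEUA
  push_cast at h
  exact h

end Summit.CriticalPhenomena.Ising3D.Control2D
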